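import Literature.MathematicalPhysics.QuantumFieldTheory.Balaban1983to89.T3MinimiserStabilityReduction
import Literature.MathematicalPhysics.QuantumFieldTheory.Balaban1983to89.T3PrintedRegularMinimiser
import Literature.MathematicalPhysics.QuantumFieldTheory.Balaban1983to89.T3TiltDescent
import Literature.MathematicalPhysics.QuantumFieldTheory.Balaban1983to89.T3UnitLawDensityEML
import Literature.MathematicalPhysics.QuantumFieldTheory.Balaban1983to89.T3DescentFibreTower
import Literature.MathematicalPhysics.QuantumFieldTheory.Balaban1983to89.Node00.CanonicalTransportOfRecord
import Literature.Probability.LatticeModels.PolymerPressure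
import HarnessLib

/-!
# THE PRODUCT-FORMULA DOOR OF LINE g19-2 «loop ledger»: a λ-uniform exponentiated cluster expansion of the constrained fluctuation integral,
# with its Gaussian normalisation displayed, GIVES the gas format GAS `BeyondOneLoopGasCan` (and GAS₁) — the hand never meets `limUnder`

Cell `ym3-torus` (YM ladder rung R3 = continuum `SU(2)` Yang–Mills on the three-torus — a RUNG, NOT d = 4, NOT infinite volume, NOT a mass gap, NOT Clay).
Width seat `ym3-torus-px20` (gen 15; WIDTH COPY of ★p1); `--supports stmt-QuantumFields-20520 --as helper`, count-neutral, definition-free, default heartbeats;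
no registry, binder or `Lines/` edit (registry v11.4 №36 untouched).  R590 (18) item (2): `Cruxes/FluctuationComparisonRegPrIntL/Lines/loop_ledger.lean` v6
(ideator ym-r3-idea-1 g19), organ REP `BeyondOneLoopRepCan`, gas door GAS `BeyondOneLoopGasCan` (§3d; ✓`beyondOneLoopRep_of_gas'` gives GAS ⟹ REP, KPL by name).

WHAT.  GAS asks, on every window `{PlaqSmall θ_J}` and at every depth `J ≤ K`, for a constant `c` and a Kotecký–Preiss gas `w` with
`f¹ U = c + F₀ U + log Ξ(w_U)`, where `f^λ U = log heightDensityCan(γ∕λ) U + β_K(γ∕λ)·minActionRegPr U` and the ONE-LOOP PART `F₀ U := limUnder_{λ→∞}(f^λ U − f^λ 1)`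
is a DEFINED limit.  A cluster-expansion hand does not produce `limUnder`s; it produces, for every `λ ≥ 1`, a PRODUCT FORMULA
`heightDensityCan(γ∕λ)(U) · e^{β_K(γ∕λ)·m(U)} = C_λ · ℓ(U) · Ξ(w^λ_U)` — Gaussian normalisation `C_λ` (datum-free; the `λ^{−dV∕2}` of Laplace's method, `dV`
datum-free by ✓`chartSmooth_docked`), the semiclassical constant `ℓ(U) > 0` (λ-free; (CLF) of LOCATE-DECAY §1), and the exponentiated expansion `Ξ(w^λ_U)` whose activities
die as `λ → ∞` (`O(g_J²∕λ)` vertices, `O(e^{−cλ})` window terms), so that `log Ξ(w^λ_U) → 0`.  THIS FILE PROVES that such a package (the letter ⟨ECE⟩, REP's quantifier prefix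
VERBATIM) implies GAS VERBATIM (δ-unfolded, since crux workfiles are not importable): `F₀ U = log ℓ U − log ℓ 1` by `Tendsto.limUnder_eq`, and at `λ = 1`,
`f¹ U = (log C₁ + log ℓ 1) + F₀ U + log Ξ(w¹_U)`.  The window datum `1` is supplied by lit ✓`T3DescentFibreTower.plaqSmall_one` ∘ ✓`T3MinimiserStabilityReduction.θBal_pos`
(`γ₁ ↦ min γ₁ 1`).
* §1 [folklore] `tendsto_sub_of_split`, `limUnder_sub_eq_of_split`, `eq_const_add_limUnder_add_of_split` — if `f λ U = a λ + g U + r λ U` on `W` for `λ ≥ 1` with `r λ U → 0`,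
  then `f λ U − f λ V → g U − g V`, and `f 1 U = (a 1 + g V) + limUnder (f · U − f · V) + r 1 U`; `log_add_eq_of_mul_exp_eq` — the logarithm of the product formula.
* §2 ★ `gasAt_of_productFormula` — ONE depth `J ≤ K`, one window: ⟨product package at `(F, γ, b₀, p₀, ε₀, J, K, κ, N)`⟩ + `PlaqSmall θ_J 1` ⟹ GAS's depth-`(J,K)` clause VERBATIM.
* §3 ★★ `beyondOneLoopGas_of_productFormula : ⟨ECE⟩ → ⟨GAS VERBATIM⟩`; ★★ `loopLedgerDepthOneGas_of_productFormula : ⟨ECE₁⟩ → ⟨GAS₁ VERBATIM⟩` (`K := J+1`).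
Door-fit (HOME cert, count-neutral): with the Lines' defs pasted, `example : ⟨ECE⟩ → BeyondOneLoopGasCan := beyondOneLoopGas_of_productFormula`.

HONEST SCOPE.  Filter∕logarithm algebra and quantifier plumbing; ⟨ECE⟩ is a HYPOTHESIS (it IS the small-field cluster expansion of [Balaban1987RG1] Thm 1 ∕ [Balaban1988Convergent]
read in d = 3 at every `λ`, in product form — XL, nobody's theorem); nothing of Bałaban's is asserted or proved; GAS, GAS₁, REP, H4ᶜ, S2β, the five registered ∘-stubs and
`FluctuationComparisonRegPrIntL` (stmt-QuantumFields-20520) are NOT proved; no summit statement is proved by a helper; rung R3 = SU(2) YM₃ on T³ — NOT d = 4, NOT infinite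
volume, NOT a mass gap, NOT Clay; the Yang–Mills mass gap is NOT proved.

References: T. Bałaban, CMP **102** (1985) 255–275 [Balaban1985UV3] ((22) p.261, (35) p.265, (41)–(47) pp.266–267); CMP **109** (1987) 249–301 [Balaban1987RG1] (Thm 1, (0.17)–(0.26)
pp.255–257); CMP **122** (1989) 355–392 [Balaban1989LargeFieldII] ((1.90) p.388, (1.97)–(1.100) pp.389–390); R. Kotecký, D. Preiss, CMP **103** (1986) 491–498 [KoteckyPreiss1986].
-/

set_option autoImplicit false

noncomputable section

open MeasureTheory Filter Topology Set
open Literature.Probability.LatticeModels (polymerPartitionFunction polyInc)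
open Literature.MathematicalPhysics.QuantumFieldTheory.Balaban1983to89
open Literature.MathematicalPhysics.QuantumFieldTheory.Balaban1983to89.T3ContinuumYM3Torus
open Literature.MathematicalPhysics.QuantumFieldTheory.Balaban1983to89.T3NestedUnitLaws
open Literature.MathematicalPhysics.QuantumFieldTheory.Balaban1983to89.T3UnitLawDensityEML
open Literature.MathematicalPhysics.QuantumFieldTheory.Balaban1983to89.T3UnitScaleTilt
open Literature.MathematicalPhysics.QuantumFieldTheory.Balaban1983to89.T3TiltDescent
open Literature.MathematicalPhysics.QuantumFieldTheory.Balaban1983to89.T3PrintedRegularMinimiser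

namespace Summit.QuantumFields.YangMills.Theorems.LoopLedgerGasOfProductFormula

/-! ## §1 Generic: a λ-family split as «datum-free + λ-free + vanishing» has normalised limit the λ-free part; the log of a product formula -/

section Generic

variable {X : Type*} {W : Set X} {f : ℝ → X → ℝ} {a : ℝ → ℝ} {g : X → ℝ} {r : ℝ → X → ℝ}

/-- If `f λ U = a λ + g U + r λ U` on `W` for `λ ≥ 1` and `r λ U → 0` for `U ∈ W`, then `f λ U − f λ V → g U − g V` (`U, V ∈ W`). [folklore] -/
theorem tendsto_sub_of_split (hsplit : ∀ lam : ℝ, 1 ≤ lam → ∀ U, U ∈ W → f lam U = a lam + g U + r lam U)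
    (hr : ∀ U, U ∈ W → Tendsto (fun lam : ℝ => r lam U) atTop (𝓝 0)) {U V : X} (hU : U ∈ W) (hV : V ∈ W) :
    Tendsto (fun lam : ℝ => f lam U - f lam V) atTop (𝓝 (g U - g V)) := by
  have h1 : (fun lam : ℝ => (g U - g V) + (r lam U - r lam V)) =ᶠ[atTop] fun lam : ℝ => f lam U - f lam V := by
    filter_upwards [eventually_ge_atTop (1 : ℝ)] with lam hlam
    rw [hsplit lam hlam U hU, hsplit lam hlam V hV]; ring
  have h2 : Tendsto (fun lam : ℝ => (g U - g V) + (r lam U - r lam V)) atTop (𝓝 ((g U - g V) + (0 - 0))) :=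
    tendsto_const_nhds.add ((hr U hU).sub (hr V hV))
  rw [sub_zero, add_zero] at h2
  exact h2.congr' h1

/-- Under the same split, `limUnder atTop (λ ↦ f λ U − f λ V) = g U − g V`. [folklore] -/
theorem limUnder_sub_eq_of_split (hsplit : ∀ lam : ℝ, 1 ≤ lam → ∀ U, U ∈ W → f lam U = a lam + g U + r lam U)
    (hr : ∀ U, U ∈ W → Tendsto (fun lam : ℝ => r lam U) atTop (𝓝 0)) {U V : X} (hU : U ∈ W) (hV : V ∈ W) :
    limUnder atTop (fun lam : ℝ => f lam U - f lam V) = g U - g V :=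
  (tendsto_sub_of_split hsplit hr hU hV).limUnder_eq

/-- Under the same split, at `λ = 1`: `f 1 U = (a 1 + g V) + limUnder atTop (λ ↦ f λ U − f λ V) + r 1 U` — the constant is datum-free once `V` is fixed. [folklore] -/
theorem eq_const_add_limUnder_add_of_split (hsplit : ∀ lam : ℝ, 1 ≤ lam → ∀ U, U ∈ W → f lam U = a lam + g U + r lam U)
    (hr : ∀ U, U ∈ W → Tendsto (fun lam : ℝ => r lam U) atTop (𝓝 0)) {U V : X} (hU : U ∈ W) (hV : V ∈ W) :
    f 1 U = (a 1 + g V) + limUnder atTop (fun lam : ℝ => f lam U - f lam V) + r 1 U := by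
  rw [limUnder_sub_eq_of_split hsplit hr hU hV, hsplit 1 le_rfl U hU]; ring

/-- The logarithm of a product formula `h · e^b = C · ℓ · Z` with `C, ℓ, Z > 0`: `log h + b = log C + log ℓ + log Z` (and `h > 0` is forced). [folklore] -/
theorem log_add_eq_of_mul_exp_eq {h b C l Z : ℝ} (hC : 0 < C) (hl : 0 < l) (hZ : 0 < Z) (heq : h * Real.exp b = C * l * Z) :
    Real.log h + b = Real.log C + Real.log l + Real.log Z := by
  have hhe : 0 < h * Real.exp b := by rw [heq]; positivity
  have hh : 0 < h := (mul_pos_iff_of_pos_right (Real.exp_pos b)).mp hhe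
  have hlog := congrArg Real.log heq
  rw [Real.log_mul hh.ne' (Real.exp_pos b).ne', Real.log_exp, Real.log_mul (mul_pos hC hl).ne' hZ.ne',
    Real.log_mul hC.ne' hl.ne'] at hlog
  exact hlog

end Generic

/-! ## §2 One depth, one window: the product package gives GAS's depth-`(J, K)` clause (texts of `heightDensityCan`, `fluctAtCan`, `oneLoopPartCan`, `gasZ`, `KPGasOn` unfolded) -/

section OneDepth

variable (F : T3Family) (γ b₀ p₀ ε₀ : ℝ) {J K : ℕ} (hJK : J ≤ K) (κ N : ℝ)

open Classical in
/-- ★ **THE PRODUCT-FORMULA DOOR AT ONE DEPTH.**  Data: a datum-free Gaussian normalisation `Cl λ > 0` (`λ ≥ 1`), a λ-free semiclassical constant `ell U > 0` on the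
window, and for every `λ` real V-local activities `w λ` on the bond polymers of `(F.P J)₀`.  Hypotheses: `w 1` is a Kotecký–Preiss gas on the window at rate `κ` with
one-bond size `≤ N` (the text of `KPGasOn`, unfolded as in ✓`…S2BetaKPLogRep.kpLogRep`); for every `λ ≥ 1` and window `U`, `Ξ(w^λ_U) > 0` and the PRODUCT FORMULA
`heightDensityCan F (γ∕λ) U · exp(β_K(γ∕λ)·minActionRegPr U) = Cl λ · ell U · Ξ(w^λ_U)`; `log Ξ(w^λ_U) → 0` as `λ → ∞` on the window; and the trivial field is a window
datum.  Conclusion: GAS's clause at `(J, K)` VERBATIM — `∃ c w₁, KPGasOn window κ N w₁ ∧ ∀ U ∈ window, fluctAtCan 1 U = c + oneLoopPartCan U + log gasZ w₁ U` — with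
`w₁ := w 1`, `c := log (Cl 1) + log (ell 1)`, and `oneLoopPartCan U = log (ell U) − log (ell 1)` identified on the way (§1).
[cite: Balaban1987RG1, (0.17)-(0.26) pp.255-257; Balaban1989LargeFieldII, (1.90) p.388; Balaban1985UV3, (35) p.265] -/
theorem gasAt_of_productFormula
    (Cl : ℝ → ℝ) (ell : GaugeField (F.P J) 0 (Matrix.specialUnitaryGroup (Fin 2) ℂ) → ℝ)
    (w : ℝ → GaugeField (F.P J) 0 (Matrix.specialUnitaryGroup (Fin 2) ℂ) → Finset (PBond (F.P J) 0) → ℝ)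
    (hCl : ∀ lam : ℝ, 1 ≤ lam → 0 < Cl lam)
    (hell : ∀ U : GaugeField (F.P J) 0 (Matrix.specialUnitaryGroup (Fin 2) ℂ), PlaqSmall (θBal F.L γ b₀ p₀ J) U → 0 < ell U)
    (hgas : ∃ (wbar a ℓ : Finset (PBond (F.P J) 0) → ℝ),
      (∀ U, w 1 U ∅ = 0) ∧
      (∀ (X : Finset (PBond (F.P J) 0)) (U U' : GaugeField (F.P J) 0 (Matrix.specialUnitaryGroup (Fin 2) ℂ)),
        (∀ e ∈ X, U e = U' e) → w 1 U X = w 1 U' X) ∧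
      (∀ X, 0 ≤ a X) ∧ (∀ X, 0 ≤ ℓ X) ∧
      (∀ U, U ∈ {U : GaugeField (F.P J) 0 (Matrix.specialUnitaryGroup (Fin 2) ℂ) | PlaqSmall (θBal F.L γ b₀ p₀ J) U} → ∀ X, |w 1 U X| ≤ wbar X) ∧
      (∀ X : Finset (PBond (F.P J) 0), ∀ e ∈ X, ∀ e' ∈ X, (e.src.tdist e'.src : ℝ) ≤ ℓ X) ∧
      (∀ X : Finset (PBond (F.P J) 0), ∑ X' ∈ Finset.univ.filter (fun X' => polyInc X' X),
          wbar X' * Real.exp (a X' + κ * ℓ X') ≤ a X) ∧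
      (∀ e : PBond (F.P J) 0, a {e} ≤ N))
    (hZpos : ∀ lam : ℝ, 1 ≤ lam → ∀ U : GaugeField (F.P J) 0 (Matrix.specialUnitaryGroup (Fin 2) ℂ), PlaqSmall (θBal F.L γ b₀ p₀ J) U →
      0 < (polymerPartitionFunction polyInc (fun X : Finset (PBond (F.P J) 0) => ((w lam U X : ℝ) : ℂ)) Finset.univ).re)
    (hprod : ∀ lam : ℝ, 1 ≤ lam → ∀ U : GaugeField (F.P J) 0 (Matrix.specialUnitaryGroup (Fin 2) ℂ), PlaqSmall (θBal F.L γ b₀ p₀ J) U →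
      Node00.canonVersion (fieldMeasure (F.P J) 0 (Matrix.specialUnitaryGroup (Fin 2) ℂ))
          (heightDensity F (γ / lam) hJK (histGood F ℰp (θBal F.L γ b₀ p₀) K J)) U
        * Real.exp ((F.scheme ℰp (γ / lam)).β K * minActionRegPr F J K hJK ε₀ U)
      = Cl lam * ell U * (polymerPartitionFunction polyInc (fun X : Finset (PBond (F.P J) 0) => ((w lam U X : ℝ) : ℂ)) Finset.univ).re)
    (hlim : ∀ U : GaugeField (F.P J) 0 (Matrix.specialUnitaryGroup (Fin 2) ℂ), PlaqSmall (θBal F.L γ b₀ p₀ J) U →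
      Tendsto (fun lam : ℝ => Real.log
        (polymerPartitionFunction polyInc (fun X : Finset (PBond (F.P J) 0) => ((w lam U X : ℝ) : ℂ)) Finset.univ).re) atTop (𝓝 0))
    (h1 : PlaqSmall (θBal F.L γ b₀ p₀ J) (1 : GaugeField (F.P J) 0 (Matrix.specialUnitaryGroup (Fin 2) ℂ))) :
    ∃ (c : ℝ) (w₁ : GaugeField (F.P J) 0 (Matrix.specialUnitaryGroup (Fin 2) ℂ) → Finset (PBond (F.P J) 0) → ℝ),
      (∃ (wbar a ℓ : Finset (PBond (F.P J) 0) → ℝ),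
        (∀ U, w₁ U ∅ = 0) ∧
        (∀ (X : Finset (PBond (F.P J) 0)) (U U' : GaugeField (F.P J) 0 (Matrix.specialUnitaryGroup (Fin 2) ℂ)),
          (∀ e ∈ X, U e = U' e) → w₁ U X = w₁ U' X) ∧
        (∀ X, 0 ≤ a X) ∧ (∀ X, 0 ≤ ℓ X) ∧
        (∀ U, U ∈ {U : GaugeField (F.P J) 0 (Matrix.specialUnitaryGroup (Fin 2) ℂ) | PlaqSmall (θBal F.L γ b₀ p₀ J) U} → ∀ X, |w₁ U X| ≤ wbar X) ∧
        (∀ X : Finset (PBond (F.P J) 0), ∀ e ∈ X, ∀ e' ∈ X, (e.src.tdist e'.src : ℝ) ≤ ℓ X) ∧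
        (∀ X : Finset (PBond (F.P J) 0), ∑ X' ∈ Finset.univ.filter (fun X' => polyInc X' X),
            wbar X' * Real.exp (a X' + κ * ℓ X') ≤ a X) ∧
        (∀ e : PBond (F.P J) 0, a {e} ≤ N)) ∧
      ∀ U : GaugeField (F.P J) 0 (Matrix.specialUnitaryGroup (Fin 2) ℂ), PlaqSmall (θBal F.L γ b₀ p₀ J) U →
        Real.log (Node00.canonVersion (fieldMeasure (F.P J) 0 (Matrix.specialUnitaryGroup (Fin 2) ℂ))
              (heightDensity F (γ / 1) hJK (histGood F ℰp (θBal F.L γ b₀ p₀) K J)) U)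
            + (F.scheme ℰp (γ / 1)).β K * minActionRegPr F J K hJK ε₀ U
          = c
            + limUnder atTop (fun lam : ℝ =>
                (Real.log (Node00.canonVersion (fieldMeasure (F.P J) 0 (Matrix.specialUnitaryGroup (Fin 2) ℂ))
                    (heightDensity F (γ / lam) hJK (histGood F ℰp (θBal F.L γ b₀ p₀) K J)) U)
                  + (F.scheme ℰp (γ / lam)).β K * minActionRegPr F J K hJK ε₀ U)
                - (Real.log (Node00.canonVersion (fieldMeasure (F.P J) 0 (Matrix.specialUnitaryGroup (Fin 2) ℂ))
                    (heightDensity F (γ / lam) hJK (histGood F ℰp (θBal F.L γ b₀ p₀) K J)) 1)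
                  + (F.scheme ℰp (γ / lam)).β K * minActionRegPr F J K hJK ε₀ 1))
            + Real.log ((polymerPartitionFunction polyInc (fun X : Finset (PBond (F.P J) 0) => ((w 1 U X : ℝ) : ℂ)) Finset.univ).re) := by
  -- the split `f λ U = log (Cl λ) + log (ell U) + log Ξ(w^λ_U)` on the window, from the product formula
  have hsplit : ∀ lam : ℝ, 1 ≤ lam → ∀ U, U ∈ {U : GaugeField (F.P J) 0 (Matrix.specialUnitaryGroup (Fin 2) ℂ) | PlaqSmall (θBal F.L γ b₀ p₀ J) U} →
      (fun (lam : ℝ) (U : GaugeField (F.P J) 0 (Matrix.specialUnitaryGroup (Fin 2) ℂ)) =>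
          Real.log (Node00.canonVersion (fieldMeasure (F.P J) 0 (Matrix.specialUnitaryGroup (Fin 2) ℂ))
              (heightDensity F (γ / lam) hJK (histGood F ℰp (θBal F.L γ b₀ p₀) K J)) U)
            + (F.scheme ℰp (γ / lam)).β K * minActionRegPr F J K hJK ε₀ U) lam U
        = (fun lam : ℝ => Real.log (Cl lam)) lam + (fun U => Real.log (ell U)) U
          + (fun (lam : ℝ) (U : GaugeField (F.P J) 0 (Matrix.specialUnitaryGroup (Fin 2) ℂ)) =>
              Real.log ((polymerPartitionFunction polyInc (fun X : Finset (PBond (F.P J) 0) => ((w lam U X : ℝ) : ℂ)) Finset.univ).re)) lam U := by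
    intro lam hlam U hU
    exact log_add_eq_of_mul_exp_eq (hCl lam hlam) (hell U hU) (hZpos lam hlam U hU) (hprod lam hlam U hU)
  have hr : ∀ U, U ∈ {U : GaugeField (F.P J) 0 (Matrix.specialUnitaryGroup (Fin 2) ℂ) | PlaqSmall (θBal F.L γ b₀ p₀ J) U} →
      Tendsto (fun lam : ℝ => (fun (lam : ℝ) (U : GaugeField (F.P J) 0 (Matrix.specialUnitaryGroup (Fin 2) ℂ)) =>
        Real.log ((polymerPartitionFunction polyInc (fun X : Finset (PBond (F.P J) 0) => ((w lam U X : ℝ) : ℂ)) Finset.univ).re)) lam U)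
        atTop (𝓝 0) := fun U hU => hlim U hU
  refine ⟨Real.log (Cl 1) + Real.log (ell 1), w 1, hgas, fun U hU => ?_⟩
  exact eq_const_add_limUnder_add_of_split hsplit hr hU h1

end OneDepth

/-! ## §3 The doors with the quantifier prefixes threaded: ⟨ECE⟩ → ⟨GAS⟩ and ⟨ECE₁⟩ → ⟨GAS₁⟩ (conclusions = `BeyondOneLoopGasCan` ∕ `LoopLedgerDepthOneGasCan` of
`Lines/loop_ledger.lean` v6 §3d with `KPGasOn`, `gasZ`, `IsLocalActivity`, `fluctAtCan`, `heightDensityCan`, `oneLoopPartCan` δ-unfolded) -/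

section Doors

open Classical in
/-- ★★ **⟨ECE⟩ → ⟨GAS⟩: A λ-UNIFORM EXPONENTIATED CLUSTER EXPANSION IN PRODUCT FORM GIVES THE GAS FORMAT OF THE BEYOND-ONE-LOOP PART.**  Hypothesis ⟨ECE⟩ («exponentiated
cluster expansion»): GAS's quantifier prefix VERBATIM (`∀ L ∃ pS … ∃ γ₁ ∃ κ ∀ F γ … ∃ Φ ≥ 0, J·Φ J → 0, ∀ J K hJK`), then the product package of §2 at one-bond size `Φ J`.
Conclusion: `BeyondOneLoopGasCan` of LINE g19-2 VERBATIM (δ-unfolded).  Proof: `γ₁ ↦ min γ₁ 1` so that the trivial field is a window datum (lit ✓`θBal_pos`, ✓`plaqSmall_one`),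
then §2 depth by depth. [cite: Balaban1987RG1, Thm 1 (0.19)-(0.26) pp.255-257; Balaban1989LargeFieldII, (1.90) p.388, (1.97)-(1.100) pp.389-390; Balaban1985UV3, (41)-(47) pp.266-267] -/
theorem beyondOneLoopGas_of_productFormula
    (hECE : ∀ (L : ℕ), ∃ pS : ℝ, ∀ (b₀ p₀ : ℝ), 0 < b₀ → pS ≤ p₀ → 0 < p₀ → ∃ ε₁ : ℝ, 0 < ε₁ ∧ ∀ (ε₀ : ℝ), 0 < ε₀ → ε₀ ≤ ε₁ →
      ∃ γ₁ : ℝ, 0 < γ₁ ∧ ∃ κ : ℝ, 0 < κ ∧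
        ∀ (F : T3Family) (γ : ℝ), F.L = L → 0 < γ → γ ≤ γ₁ →
          ∃ Φ : ℕ → ℝ, (∀ J, 0 ≤ Φ J) ∧ Tendsto (fun J : ℕ => (J : ℝ) * Φ J) atTop (𝓝 0) ∧
            ∀ (J K : ℕ) (hJK : J ≤ K),
              ∃ (Cl : ℝ → ℝ) (ell : GaugeField (F.P J) 0 (Matrix.specialUnitaryGroup (Fin 2) ℂ) → ℝ)
                (w : ℝ → GaugeField (F.P J) 0 (Matrix.specialUnitaryGroup (Fin 2) ℂ) → Finset (PBond (F.P J) 0) → ℝ),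
              (∀ lam : ℝ, 1 ≤ lam → 0 < Cl lam) ∧
              (∀ U : GaugeField (F.P J) 0 (Matrix.specialUnitaryGroup (Fin 2) ℂ), PlaqSmall (θBal F.L γ b₀ p₀ J) U → 0 < ell U) ∧
              (∃ (wbar a ℓ : Finset (PBond (F.P J) 0) → ℝ),
                (∀ U, w 1 U ∅ = 0) ∧
                (∀ (X : Finset (PBond (F.P J) 0)) (U U' : GaugeField (F.P J) 0 (Matrix.specialUnitaryGroup (Fin 2) ℂ)),
                  (∀ e ∈ X, U e = U' e) → w 1 U X = w 1 U' X) ∧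
                (∀ X, 0 ≤ a X) ∧ (∀ X, 0 ≤ ℓ X) ∧
                (∀ U, U ∈ {U : GaugeField (F.P J) 0 (Matrix.specialUnitaryGroup (Fin 2) ℂ) | PlaqSmall (θBal F.L γ b₀ p₀ J) U} → ∀ X, |w 1 U X| ≤ wbar X) ∧
                (∀ X : Finset (PBond (F.P J) 0), ∀ e ∈ X, ∀ e' ∈ X, (e.src.tdist e'.src : ℝ) ≤ ℓ X) ∧
                (∀ X : Finset (PBond (F.P J) 0), ∑ X' ∈ Finset.univ.filter (fun X' => polyInc X' X),
                    wbar X' * Real.exp (a X' + κ * ℓ X') ≤ a X) ∧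
                (∀ e : PBond (F.P J) 0, a {e} ≤ (Φ J))) ∧
              (∀ lam : ℝ, 1 ≤ lam → ∀ U : GaugeField (F.P J) 0 (Matrix.specialUnitaryGroup (Fin 2) ℂ), PlaqSmall (θBal F.L γ b₀ p₀ J) U →
                0 < (polymerPartitionFunction polyInc (fun X : Finset (PBond (F.P J) 0) => ((w lam U X : ℝ) : ℂ)) Finset.univ).re ∧
                Node00.canonVersion (fieldMeasure (F.P J) 0 (Matrix.specialUnitaryGroup (Fin 2) ℂ))
                    (heightDensity F (γ / lam) hJK (histGood F ℰp (θBal F.L γ b₀ p₀) K J)) U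
                  * Real.exp ((F.scheme ℰp (γ / lam)).β K * minActionRegPr F J K hJK ε₀ U)
                = Cl lam * ell U * (polymerPartitionFunction polyInc (fun X : Finset (PBond (F.P J) 0) => ((w lam U X : ℝ) : ℂ)) Finset.univ).re) ∧
              (∀ U : GaugeField (F.P J) 0 (Matrix.specialUnitaryGroup (Fin 2) ℂ), PlaqSmall (θBal F.L γ b₀ p₀ J) U →
                Tendsto (fun lam : ℝ => Real.log (polymerPartitionFunction polyInc (fun X : Finset (PBond (F.P J) 0) => ((w lam U X : ℝ) : ℂ)) Finset.univ).re) atTop (𝓝 0))) :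
    ∀ (L : ℕ), ∃ pS : ℝ, ∀ (b₀ p₀ : ℝ), 0 < b₀ → pS ≤ p₀ → 0 < p₀ → ∃ ε₁ : ℝ, 0 < ε₁ ∧ ∀ (ε₀ : ℝ), 0 < ε₀ → ε₀ ≤ ε₁ →
      ∃ γ₁ : ℝ, 0 < γ₁ ∧ ∃ κ : ℝ, 0 < κ ∧
        ∀ (F : T3Family) (γ : ℝ), F.L = L → 0 < γ → γ ≤ γ₁ →
          ∃ Φ : ℕ → ℝ, (∀ J, 0 ≤ Φ J) ∧ Tendsto (fun J : ℕ => (J : ℝ) * Φ J) atTop (𝓝 0) ∧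
            ∀ (J K : ℕ) (hJK : J ≤ K),
              ∃ (c : ℝ) (w : GaugeField (F.P J) 0 (Matrix.specialUnitaryGroup (Fin 2) ℂ) → Finset (PBond (F.P J) 0) → ℝ),
                (∃ (wbar a ℓ : Finset (PBond (F.P J) 0) → ℝ),
                (∀ U, w U ∅ = 0) ∧
                (∀ (X : Finset (PBond (F.P J) 0)) (U U' : GaugeField (F.P J) 0 (Matrix.specialUnitaryGroup (Fin 2) ℂ)),
                  (∀ e ∈ X, U e = U' e) → w U X = w U' X) ∧
                (∀ X, 0 ≤ a X) ∧ (∀ X, 0 ≤ ℓ X) ∧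
                (∀ U, U ∈ {U : GaugeField (F.P J) 0 (Matrix.specialUnitaryGroup (Fin 2) ℂ) | PlaqSmall (θBal F.L γ b₀ p₀ J) U} → ∀ X, |w U X| ≤ wbar X) ∧
                (∀ X : Finset (PBond (F.P J) 0), ∀ e ∈ X, ∀ e' ∈ X, (e.src.tdist e'.src : ℝ) ≤ ℓ X) ∧
                (∀ X : Finset (PBond (F.P J) 0), ∑ X' ∈ Finset.univ.filter (fun X' => polyInc X' X),
                    wbar X' * Real.exp (a X' + κ * ℓ X') ≤ a X) ∧
                (∀ e : PBond (F.P J) 0, a {e} ≤ (Φ J))) ∧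
                ∀ U : GaugeField (F.P J) 0 (Matrix.specialUnitaryGroup (Fin 2) ℂ), PlaqSmall (θBal F.L γ b₀ p₀ J) U →
                  (Real.log (Node00.canonVersion (fieldMeasure (F.P J) 0 (Matrix.specialUnitaryGroup (Fin 2) ℂ))
                      (heightDensity F (γ / 1) hJK (histGood F ℰp (θBal F.L γ b₀ p₀) K J)) U)
                    + (F.scheme ℰp (γ / 1)).β K * minActionRegPr F J K hJK ε₀ U)
                    = c + limUnder atTop (fun lam : ℝ => (Real.log (Node00.canonVersion (fieldMeasure (F.P J) 0 (Matrix.specialUnitaryGroup (Fin 2) ℂ))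
                      (heightDensity F (γ / lam) hJK (histGood F ℰp (θBal F.L γ b₀ p₀) K J)) U)
                    + (F.scheme ℰp (γ / lam)).β K * minActionRegPr F J K hJK ε₀ U) - (Real.log (Node00.canonVersion (fieldMeasure (F.P J) 0 (Matrix.specialUnitaryGroup (Fin 2) ℂ))
                      (heightDensity F (γ / lam) hJK (histGood F ℰp (θBal F.L γ b₀ p₀) K J)) 1)
                    + (F.scheme ℰp (γ / lam)).β K * minActionRegPr F J K hJK ε₀ 1))
                      + Real.log (polymerPartitionFunction polyInc (fun X : Finset (PBond (F.P J) 0) => ((w U X : ℝ) : ℂ)) Finset.univ).re := by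
  intro L
  obtain ⟨pS, H⟩ := hECE L
  refine ⟨pS, fun b₀ p₀ hb hp hp0 => ?_⟩
  obtain ⟨ε₁, hε₁, H1⟩ := H b₀ p₀ hb hp hp0
  refine ⟨ε₁, hε₁, fun ε₀ hε₀ hε₀le => ?_⟩
  obtain ⟨γ₁, hγ₁, κ, hκ, H2⟩ := H1 ε₀ hε₀ hε₀le
  refine ⟨min γ₁ 1, lt_min hγ₁ one_pos, κ, hκ, fun F γ hFL hγ hγle => ?_⟩
  obtain ⟨Φ, hΦ0, hΦ, H3⟩ := H2 F γ hFL hγ (hγle.trans (min_le_left _ _))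
  refine ⟨Φ, hΦ0, hΦ, fun J K hJK => ?_⟩
  obtain ⟨Cl, ell, w, hCl, hell, hgas, hprodZ, hlim⟩ := H3 J K hJK
  have h1 : PlaqSmall (θBal F.L γ b₀ p₀ J) (1 : GaugeField (F.P J) 0 (Matrix.specialUnitaryGroup (Fin 2) ℂ)) :=
    T3DescentFibreTower.plaqSmall_one (T3MinimiserStabilityReduction.θBal_pos (le_of_lt F.hL.2) hγ (hγle.trans (min_le_right _ _)) hb p₀ J)
  refine ⟨Real.log (Cl 1) + Real.log (ell 1), w 1, hgas, fun U hU => ?_⟩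
  have hsplit : ∀ lam : ℝ, 1 ≤ lam → ∀ U, U ∈ {U : GaugeField (F.P J) 0 (Matrix.specialUnitaryGroup (Fin 2) ℂ) | PlaqSmall (θBal F.L γ b₀ p₀ J) U} →
      (fun (lam : ℝ) (U : GaugeField (F.P J) 0 (Matrix.specialUnitaryGroup (Fin 2) ℂ)) =>
          Real.log (Node00.canonVersion (fieldMeasure (F.P J) 0 (Matrix.specialUnitaryGroup (Fin 2) ℂ))
              (heightDensity F (γ / lam) hJK (histGood F ℰp (θBal F.L γ b₀ p₀) K J)) U)
            + (F.scheme ℰp (γ / lam)).β K * minActionRegPr F J K hJK ε₀ U) lam U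
        = (fun lam : ℝ => Real.log (Cl lam)) lam + (fun U => Real.log (ell U)) U
          + (fun (lam : ℝ) (U : GaugeField (F.P J) 0 (Matrix.specialUnitaryGroup (Fin 2) ℂ)) =>
              Real.log ((polymerPartitionFunction polyInc (fun X : Finset (PBond (F.P J) 0) => ((w lam U X : ℝ) : ℂ)) Finset.univ).re)) lam U :=
    fun lam hlam U hU => log_add_eq_of_mul_exp_eq (hCl lam hlam) (hell U hU) (hprodZ lam hlam U hU).1 (hprodZ lam hlam U hU).2
  exact eq_const_add_limUnder_add_of_split hsplit (fun U hU => hlim U hU) hU h1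

open Classical in
/-- ★★ **⟨ECE₁⟩ → ⟨GAS₁⟩: THE DEPTH-ONE DOOR** (`K := J + 1`, ONE constrained fluctuation integral — the hands' first rung): the same package at `hJK := Nat.le_succ J`
gives `LoopLedgerDepthOneGasCan` of LINE g19-2 VERBATIM (δ-unfolded). [cite: Balaban1985UV3, (25)-(37) pp.262-265; Balaban1987RG1, (0.26) p.257] -/
theorem loopLedgerDepthOneGas_of_productFormula
    (hECE : ∀ (L : ℕ), ∃ pS : ℝ, ∀ (b₀ p₀ : ℝ), 0 < b₀ → pS ≤ p₀ → 0 < p₀ → ∃ ε₁ : ℝ, 0 < ε₁ ∧ ∀ (ε₀ : ℝ), 0 < ε₀ → ε₀ ≤ ε₁ →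
      ∃ γ₁ : ℝ, 0 < γ₁ ∧ ∃ κ : ℝ, 0 < κ ∧
        ∀ (F : T3Family) (γ : ℝ), F.L = L → 0 < γ → γ ≤ γ₁ →
          ∃ Φ : ℕ → ℝ, (∀ J, 0 ≤ Φ J) ∧ Tendsto (fun J : ℕ => (J : ℝ) * Φ J) atTop (𝓝 0) ∧
            ∀ (J : ℕ),
              ∃ (Cl : ℝ → ℝ) (ell : GaugeField (F.P J) 0 (Matrix.specialUnitaryGroup (Fin 2) ℂ) → ℝ)
                (w : ℝ → GaugeField (F.P J) 0 (Matrix.specialUnitaryGroup (Fin 2) ℂ) → Finset (PBond (F.P J) 0) → ℝ),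
              (∀ lam : ℝ, 1 ≤ lam → 0 < Cl lam) ∧
              (∀ U : GaugeField (F.P J) 0 (Matrix.specialUnitaryGroup (Fin 2) ℂ), PlaqSmall (θBal F.L γ b₀ p₀ J) U → 0 < ell U) ∧
              (∃ (wbar a ℓ : Finset (PBond (F.P J) 0) → ℝ),
                (∀ U, w 1 U ∅ = 0) ∧
                (∀ (X : Finset (PBond (F.P J) 0)) (U U' : GaugeField (F.P J) 0 (Matrix.specialUnitaryGroup (Fin 2) ℂ)),
                  (∀ e ∈ X, U e = U' e) → w 1 U X = w 1 U' X) ∧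
                (∀ X, 0 ≤ a X) ∧ (∀ X, 0 ≤ ℓ X) ∧
                (∀ U, U ∈ {U : GaugeField (F.P J) 0 (Matrix.specialUnitaryGroup (Fin 2) ℂ) | PlaqSmall (θBal F.L γ b₀ p₀ J) U} → ∀ X, |w 1 U X| ≤ wbar X) ∧
                (∀ X : Finset (PBond (F.P J) 0), ∀ e ∈ X, ∀ e' ∈ X, (e.src.tdist e'.src : ℝ) ≤ ℓ X) ∧
                (∀ X : Finset (PBond (F.P J) 0), ∑ X' ∈ Finset.univ.filter (fun X' => polyInc X' X),
                    wbar X' * Real.exp (a X' + κ * ℓ X') ≤ a X) ∧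
                (∀ e : PBond (F.P J) 0, a {e} ≤ (Φ J))) ∧
              (∀ lam : ℝ, 1 ≤ lam → ∀ U : GaugeField (F.P J) 0 (Matrix.specialUnitaryGroup (Fin 2) ℂ), PlaqSmall (θBal F.L γ b₀ p₀ J) U →
                0 < (polymerPartitionFunction polyInc (fun X : Finset (PBond (F.P J) 0) => ((w lam U X : ℝ) : ℂ)) Finset.univ).re ∧
                Node00.canonVersion (fieldMeasure (F.P J) 0 (Matrix.specialUnitaryGroup (Fin 2) ℂ))
                    (heightDensity F (γ / lam) (Nat.le_succ J) (histGood F ℰp (θBal F.L γ b₀ p₀) (J + 1) J)) U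
                  * Real.exp ((F.scheme ℰp (γ / lam)).β (J + 1) * minActionRegPr F J (J + 1) (Nat.le_succ J) ε₀ U)
                = Cl lam * ell U * (polymerPartitionFunction polyInc (fun X : Finset (PBond (F.P J) 0) => ((w lam U X : ℝ) : ℂ)) Finset.univ).re) ∧
              (∀ U : GaugeField (F.P J) 0 (Matrix.specialUnitaryGroup (Fin 2) ℂ), PlaqSmall (θBal F.L γ b₀ p₀ J) U →
                Tendsto (fun lam : ℝ => Real.log (polymerPartitionFunction polyInc (fun X : Finset (PBond (F.P J) 0) => ((w lam U X : ℝ) : ℂ)) Finset.univ).re) atTop (𝓝 0))) :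
    ∀ (L : ℕ), ∃ pS : ℝ, ∀ (b₀ p₀ : ℝ), 0 < b₀ → pS ≤ p₀ → 0 < p₀ → ∃ ε₁ : ℝ, 0 < ε₁ ∧ ∀ (ε₀ : ℝ), 0 < ε₀ → ε₀ ≤ ε₁ →
      ∃ γ₁ : ℝ, 0 < γ₁ ∧ ∃ κ : ℝ, 0 < κ ∧
        ∀ (F : T3Family) (γ : ℝ), F.L = L → 0 < γ → γ ≤ γ₁ →
          ∃ Φ : ℕ → ℝ, (∀ J, 0 ≤ Φ J) ∧ Tendsto (fun J : ℕ => (J : ℝ) * Φ J) atTop (𝓝 0) ∧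
            ∀ (J : ℕ),
              ∃ (c : ℝ) (w : GaugeField (F.P J) 0 (Matrix.specialUnitaryGroup (Fin 2) ℂ) → Finset (PBond (F.P J) 0) → ℝ),
                (∃ (wbar a ℓ : Finset (PBond (F.P J) 0) → ℝ),
                (∀ U, w U ∅ = 0) ∧
                (∀ (X : Finset (PBond (F.P J) 0)) (U U' : GaugeField (F.P J) 0 (Matrix.specialUnitaryGroup (Fin 2) ℂ)),
                  (∀ e ∈ X, U e = U' e) → w U X = w U' X) ∧
                (∀ X, 0 ≤ a X) ∧ (∀ X, 0 ≤ ℓ X) ∧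
                (∀ U, U ∈ {U : GaugeField (F.P J) 0 (Matrix.specialUnitaryGroup (Fin 2) ℂ) | PlaqSmall (θBal F.L γ b₀ p₀ J) U} → ∀ X, |w U X| ≤ wbar X) ∧
                (∀ X : Finset (PBond (F.P J) 0), ∀ e ∈ X, ∀ e' ∈ X, (e.src.tdist e'.src : ℝ) ≤ ℓ X) ∧
                (∀ X : Finset (PBond (F.P J) 0), ∑ X' ∈ Finset.univ.filter (fun X' => polyInc X' X),
                    wbar X' * Real.exp (a X' + κ * ℓ X') ≤ a X) ∧
                (∀ e : PBond (F.P J) 0, a {e} ≤ (Φ J))) ∧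
                ∀ U : GaugeField (F.P J) 0 (Matrix.specialUnitaryGroup (Fin 2) ℂ), PlaqSmall (θBal F.L γ b₀ p₀ J) U →
                  (Real.log (Node00.canonVersion (fieldMeasure (F.P J) 0 (Matrix.specialUnitaryGroup (Fin 2) ℂ))
                      (heightDensity F (γ / 1) (Nat.le_succ J) (histGood F ℰp (θBal F.L γ b₀ p₀) (J + 1) J)) U)
                    + (F.scheme ℰp (γ / 1)).β (J + 1) * minActionRegPr F J (J + 1) (Nat.le_succ J) ε₀ U)
                    = c + limUnder atTop (fun lam : ℝ => (Real.log (Node00.canonVersion (fieldMeasure (F.P J) 0 (Matrix.specialUnitaryGroup (Fin 2) ℂ))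
                      (heightDensity F (γ / lam) (Nat.le_succ J) (histGood F ℰp (θBal F.L γ b₀ p₀) (J + 1) J)) U)
                    + (F.scheme ℰp (γ / lam)).β (J + 1) * minActionRegPr F J (J + 1) (Nat.le_succ J) ε₀ U) - (Real.log (Node00.canonVersion (fieldMeasure (F.P J) 0 (Matrix.specialUnitaryGroup (Fin 2) ℂ))
                      (heightDensity F (γ / lam) (Nat.le_succ J) (histGood F ℰp (θBal F.L γ b₀ p₀) (J + 1) J)) 1)
                    + (F.scheme ℰp (γ / lam)).β (J + 1) * minActionRegPr F J (J + 1) (Nat.le_succ J) ε₀ 1))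
                      + Real.log (polymerPartitionFunction polyInc (fun X : Finset (PBond (F.P J) 0) => ((w U X : ℝ) : ℂ)) Finset.univ).re := by
  intro L
  obtain ⟨pS, H⟩ := hECE L
  refine ⟨pS, fun b₀ p₀ hb hp hp0 => ?_⟩
  obtain ⟨ε₁, hε₁, H1⟩ := H b₀ p₀ hb hp hp0
  refine ⟨ε₁, hε₁, fun ε₀ hε₀ hε₀le => ?_⟩
  obtain ⟨γ₁, hγ₁, κ, hκ, H2⟩ := H1 ε₀ hε₀ hε₀le
  refine ⟨min γ₁ 1, lt_min hγ₁ one_pos, κ, hκ, fun F γ hFL hγ hγle => ?_⟩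
  obtain ⟨Φ, hΦ0, hΦ, H3⟩ := H2 F γ hFL hγ (hγle.trans (min_le_left _ _))
  refine ⟨Φ, hΦ0, hΦ, fun J => ?_⟩
  obtain ⟨Cl, ell, w, hCl, hell, hgas, hprodZ, hlim⟩ := H3 J
  have h1 : PlaqSmall (θBal F.L γ b₀ p₀ J) (1 : GaugeField (F.P J) 0 (Matrix.specialUnitaryGroup (Fin 2) ℂ)) :=
    T3DescentFibreTower.plaqSmall_one (T3MinimiserStabilityReduction.θBal_pos (le_of_lt F.hL.2) hγ (hγle.trans (min_le_right _ _)) hb p₀ J)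
  refine ⟨Real.log (Cl 1) + Real.log (ell 1), w 1, hgas, fun U hU => ?_⟩
  have hsplit : ∀ lam : ℝ, 1 ≤ lam → ∀ U, U ∈ {U : GaugeField (F.P J) 0 (Matrix.specialUnitaryGroup (Fin 2) ℂ) | PlaqSmall (θBal F.L γ b₀ p₀ J) U} →
      (fun (lam : ℝ) (U : GaugeField (F.P J) 0 (Matrix.specialUnitaryGroup (Fin 2) ℂ)) =>
          Real.log (Node00.canonVersion (fieldMeasure (F.P J) 0 (Matrix.specialUnitaryGroup (Fin 2) ℂ))
              (heightDensity F (γ / lam) (Nat.le_succ J) (histGood F ℰp (θBal F.L γ b₀ p₀) (J + 1) J)) U)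
            + (F.scheme ℰp (γ / lam)).β (J + 1) * minActionRegPr F J (J + 1) (Nat.le_succ J) ε₀ U) lam U
        = (fun lam : ℝ => Real.log (Cl lam)) lam + (fun U => Real.log (ell U)) U
          + (fun (lam : ℝ) (U : GaugeField (F.P J) 0 (Matrix.specialUnitaryGroup (Fin 2) ℂ)) =>
              Real.log ((polymerPartitionFunction polyInc (fun X : Finset (PBond (F.P J) 0) => ((w lam U X : ℝ) : ℂ)) Finset.univ).re)) lam U :=
    fun lam hlam U hU => log_add_eq_of_mul_exp_eq (hCl lam hlam) (hell U hU) (hprodZ lam hlam U hU).1 (hprodZ lam hlam U hU).2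
  exact eq_const_add_limUnder_add_of_split hsplit (fun U hU => hlim U hU) hU h1

end Doors

end Summit.QuantumFields.YangMills.Theorems.LoopLedgerGasOfProductFormula

end
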